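import Mathlib
import Summits.NavierStokesRegularity.NavierStokesRegularity.Theorems.ThreadingFluxSilentShellsJiuXinLiouville
import Summits.NavierStokesRegularity.NavierStokesRegularity.Theorems.ThreadingFluxPoloidalLiouvillePrecessionSwirl
import HarnessLib

/-!
# Crux `PoloidalLiouville` (stmt-NavierStokesRegularity-1222, W1), crux idea «silent-shells» (ns-idea-15 g8):
# E0 DECIDED in the axisymmetric class — unconditionally

The residual inviscid crux E0 `UnthreadedCompactonTrivial` of the silent-shells card («every compactly supported `C¹`
steady Euler flow threads every point») is OPEN in general.  In the AXISYMMETRIC class it is decided: an axisymmetric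
compactly supported `C¹` steady Euler flow whose vorticity is tangent to every sphere about a point of its axis has no
swirl (I3, tree `ThreadingFluxPoloidalLiouvillePrecessionSwirl.unthreadedAxisymmetricNoSwirl`, `C¹`), hence VANISHES by
the now unconditional Jiu–Xin compact Liouville theorem `SilentShells.jiuXin_noSwirl_liouville`
(`ThreadingFluxSilentShellsJiuXinLiouville`).  This is the sketch's `unthreadedCompactonTrivial_axisymmetric_C1`
(`Cruxes/PoloidalLiouville/SilentShellsSketch.lean` v1.4 l.778) with its hypothesis `hJX` DISCHARGED, by name
(`IsSteadyEulerC1` and `IsUnthreadedAbout 0` δ-unfolded), plus the version about an arbitrary axis point.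

`--supports stmt-NavierStokesRegularity-1222 --as helper`; W1 movement 0; NS regularity is NOT proved by any of this.
-/

-- the summit and its single problem share the name (D-0017 nested layout)
set_option linter.dupNamespace false

noncomputable section

namespace Summit.NavierStokesRegularity.NavierStokesRegularity.Theorems.PoloidalLiouville.SilentShells

open scoped RealInnerProductSpace
open Literature.Analysis.FluidPDE

/-- **E0 in the axisymmetric class, about any axis point** (unconditional): a compactly supported `C¹` steady Euler
pair `(U, P)` with `U` axisymmetric and UNTHREADED about an axis point `c e₂` — `⟪x − c e₂, curl U x⟫ = 0` for all
`x` — has `U ≡ 0` (I3 `unthreadedAxisymmetricNoSwirl` ⇒ no swirl; then `jiuXin_noSwirl_liouville`).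
[cite: JiuXin2008, Thm 5.3] -/
theorem unthreadedCompactonTrivial_axisymmetric_axisPoint
    {U : EuclideanSpace ℝ (Fin 3) → EuclideanSpace ℝ (Fin 3)} {P : EuclideanSpace ℝ (Fin 3) → ℝ}
    (hE : ContDiff ℝ 1 U ∧ ContDiff ℝ 1 P ∧ VectorCalculus.IsDivFree U ∧ ∀ x, convect U U x + gradient P x = 0)
    (hc : HasCompactSupport U) (hax : IsAxisymmetric U) (c : ℝ)
    (hun : ∀ x, ⟪x - EuclideanSpace.single (2 : Fin 3) c, curl U x⟫ = 0) : U = 0 :=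
  jiuXin_noSwirl_liouville U P hE hc hax
    (ThreadingFluxPoloidalLiouvillePrecessionSwirl.unthreadedAxisymmetricNoSwirl U c hE.1 hax hun)

/-- **E0 in the axisymmetric class** — sketch v1.4 l.778 `unthreadedCompactonTrivial_axisymmetric_C1` with the Jiu–Xin
hypothesis DISCHARGED (by name; `IsSteadyEulerC1 U P` and `IsUnthreadedAbout 0 U` δ-unfolded): an axisymmetric
compactly supported `C¹` steady Euler flow unthreaded about the origin is trivial.  So an E0 counterexample (an
unthreaded Gavrilov-type compacton) is necessarily NON-axisymmetric about every axis through the centre.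
[cite: JiuXin2008, Thm 5.3] -/
theorem unthreadedCompactonTrivial_axisymmetric
    {U : EuclideanSpace ℝ (Fin 3) → EuclideanSpace ℝ (Fin 3)} {P : EuclideanSpace ℝ (Fin 3) → ℝ}
    (hE : ContDiff ℝ 1 U ∧ ContDiff ℝ 1 P ∧ VectorCalculus.IsDivFree U ∧ ∀ x, convect U U x + gradient P x = 0)
    (hc : HasCompactSupport U) (hax : IsAxisymmetric U)
    (hun : ∀ x, ⟪x - 0, curl U x⟫ = 0) : U = 0 := by
  refine unthreadedCompactonTrivial_axisymmetric_axisPoint hE hc hax 0 fun x => ?_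
  have h0 : EuclideanSpace.single (2 : Fin 3) (0 : ℝ) = (0 : EuclideanSpace ℝ (Fin 3)) := by
    ext i; fin_cases i <;> simp
  rw [h0]
  exact hun x

end Summit.NavierStokesRegularity.NavierStokesRegularity.Theorems.PoloidalLiouville.SilentShells

end
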